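import Mathlib
import Literature.Analysis.FluidPDE.SelfSimilarEulerProfile
import HarnessLib

/-!
# Crux `EulerZoomLiouville.PowerGaugeEulerLiouville` (stmt-NavierStokesRegularity-19832), weak stratum, line `weak_lagrangian` (ns-idea-11 g9):
# THE LAGRANGIAN CHAIN RULE FOR `C¹` OBSERVABLES ALONG A.E. BACKWARD ORBIT — the smooth half of `stub_chainRule` (F2)

Route №10 `EulerZoomLiouville` (NavierStokesRegularity), crux E = stmt-NavierStokesRegularity-19832; width seat ns-ezl-w1 g8 under the LEAD ns-typeII-p2 g14.
`stub_chainRule` of `Lines/weak_lagrangian.lean` asks, for the backward regular Lagrangian flow `Ψ` of `−W` (a.e. label: `σ ↦ Ψ_σ y` is an integral curve in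
INTEGRAL form, `Ψ_σ y = y − ∫₀^σ W(Ψ_s y) ds`), the chain rule `f(Ψ_σ y) = f(y) − ∫₀^σ g(Ψ_s y)[W(Ψ_s y)] ds` for every `f ∈ W^{1,1}_loc` with weak gradient
`g ∈ L^{3/2}_loc`.  Its proof has two halves: (i) `C¹` observables along ONE absolutely continuous integral curve; (ii) mollification `f_ε → f` and the Jacobian law.
This file is half (i), the part that needs no measure theory on the labels and no property of the member:

* `comp_curve_eq_sub_integral` — **deterministic**: `w ∈ L¹(0,σ)`, `γ(s) = y − ∫₀^s w` on `[0,σ]`, `f ∈ C¹(ℝ³)` ⇒ `s ↦ Df(γ s)[w s]` is integrable on `(0,σ)` and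
  `f(γ σ) = f(y) − ∫₀^σ Df(γ s)[w s] ds`.  (Mathlib has no FTC for absolutely continuous functions; proof by approximating `w` in `L¹` by continuous `w_ε`
  (`MemLp.exists_boundedContinuous_eLpNorm_sub_le`), FTC for the `C¹` curves `γ_ε = y − ∫ w_ε`, and explicit error bounds from the mean-value inequality and the
  uniform continuity of `Df` on a compact ball containing all curves.)
* `chainRule_of_contDiff` — along the flow: if a.e. label has an integral curve on `[0,∞)`, then for every `σ ≥ 0` and a.e. `y`,
  `f(Ψ_σ y) = f(y) − ∫₀^σ Df(Ψ_s y)[W(Ψ_s y)] ds` (`W = selfSimilarTransport γ 0 V`): `HasChainRule` of the line for `C¹` observables (`g = fderiv f`).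

WHAT THIS IS NOT: not NS, not E, not `stub_chainRule` (the Sobolev half (ii) remains) — a brick `--supports` stmt-19832; 19832 is OPEN.
[folklore; AmbrosioCrippa2008 (RLF setting); Evans2010 App. C.4]
-/

noncomputable section

-- flat `Theorems/<Route><Decl>…` files of one crux share the namespace of the crux (tree convention)
set_option linter.dupNamespace false

open MeasureTheory Set Filter Topology Metric Function TopologicalSpace ContinuousLinearMap intervalIntegral
open scoped ENNReal NNReal InnerProductSpace RealInnerProductSpace ContDiff

namespace Summit.NavierStokesRegularity.NavierStokesRegularity.Theorems.PowerGaugeEulerLiouville.WeakLagrangian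

open Literature.Analysis Literature.Analysis.FluidPDE

/-! ### A primitive of an `L¹` function: continuity and confinement -/

/-- `‖∫₀^s w‖ ≤ ∫₀^σ ‖w‖` for `0 ≤ s ≤ σ`. [folklore] -/
theorem norm_integral_le_integral_norm_of_mem {w : ℝ → EuclideanSpace ℝ (Fin 3)} {σ : ℝ}
    (hw : IntervalIntegrable w volume 0 σ) {s : ℝ} (hs : s ∈ Icc 0 σ) :
    ‖∫ r in (0 : ℝ)..s, w r‖ ≤ ∫ r in (0 : ℝ)..σ, ‖w r‖ := by
  calc ‖∫ r in (0 : ℝ)..s, w r‖ ≤ ∫ r in (0 : ℝ)..s, ‖w r‖ := norm_integral_le_integral_norm hs.1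
    _ ≤ ∫ r in (0 : ℝ)..σ, ‖w r‖ :=
        integral_mono_interval le_rfl hs.1 hs.2 (Eventually.of_forall fun _ => norm_nonneg _) hw.norm

/-! ### The deterministic chain rule along an absolutely continuous curve -/

/-- **CHAIN RULE ALONG AN INTEGRAL CURVE IN INTEGRAL FORM.**  Let `w ∈ L¹(0,σ)` (`σ ≥ 0`), `γ(s) = y − ∫₀^s w` for `s ∈ [0,σ]`, and `f ∈ C¹(ℝ³; ℝ)`.  Then
`s ↦ Df(γ s)[w s]` is integrable on `(0,σ)` and `f(γ σ) = f(y) − ∫₀^σ Df(γ s)[w s] ds`. [folklore; Evans2010 App. C.4 (approximation by continuous functions)] -/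
theorem comp_curve_eq_sub_integral {f : EuclideanSpace ℝ (Fin 3) → ℝ} (hf : ContDiff ℝ 1 f)
    {w γ : ℝ → EuclideanSpace ℝ (Fin 3)} {y : EuclideanSpace ℝ (Fin 3)} {σ : ℝ} (hσ : 0 ≤ σ)
    (hw : IntervalIntegrable w volume 0 σ) (hγ : ∀ s ∈ Icc 0 σ, γ s = y - ∫ r in (0 : ℝ)..s, w r) :
    IntervalIntegrable (fun s => fderiv ℝ f (γ s) (w s)) volume 0 σ ∧
      f (γ σ) = f y - ∫ s in (0 : ℝ)..σ, fderiv ℝ f (γ s) (w s) := by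
  have hfd : Differentiable ℝ f := hf.differentiable_one
  have hDfc : Continuous (fderiv ℝ f) := hf.continuous_fderiv one_ne_zero
  -- ### the compact ball containing all curves, and bounds for `Df` there
  set I : ℝ := ∫ r in (0 : ℝ)..σ, ‖w r‖ with hI
  have hI0 : 0 ≤ I := integral_nonneg hσ fun _ _ => norm_nonneg _
  set K : Set (EuclideanSpace ℝ (Fin 3)) := closedBall y (I + 1) with hK
  have hKc : IsCompact K := isCompact_closedBall _ _
  have hKconv : Convex ℝ K := convex_closedBall _ _
  obtain ⟨M, hM⟩ := hKc.exists_bound_of_continuousOn hDfc.continuousOn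
  have hM0 : 0 ≤ M := (norm_nonneg _).trans (hM y (mem_closedBall_self (by linarith)))
  -- ### `γ` is continuous on `[0,σ]` and stays in `closedBall y I`
  have hγc : ContinuousOn γ (Icc 0 σ) := by
    have h1 : ContinuousOn (fun s => y - ∫ r in (0 : ℝ)..s, w r) (uIcc 0 σ) :=
      continuousOn_const.sub (continuousOn_primitive_interval' hw (by rw [uIcc_of_le hσ]; exact ⟨le_rfl, hσ⟩))
    rw [uIcc_of_le hσ] at h1
    exact h1.congr fun s hs => hγ s hs
  have hγK : ∀ s ∈ Icc 0 σ, γ s ∈ closedBall y I := fun s hs => by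
    rw [mem_closedBall, dist_eq_norm, hγ s hs, sub_sub_cancel_left, norm_neg]
    exact norm_integral_le_integral_norm_of_mem hw hs
  have hγK' : ∀ s ∈ Icc 0 σ, γ s ∈ K := fun s hs => closedBall_subset_closedBall (by linarith) (hγK s hs)
  -- ### integrability of `Df(γ)[w]`
  have hm : AEStronglyMeasurable (fun s => fderiv ℝ f (γ s) (w s)) (volume.restrict (uIoc 0 σ)) := by
    have h1 : AEStronglyMeasurable (fun s => fderiv ℝ f (γ s)) (volume.restrict (uIoc 0 σ)) := by
      have h2 : ContinuousOn (fun s => fderiv ℝ f (γ s)) (Icc 0 σ) := hDfc.comp_continuousOn hγc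
      rw [uIoc_of_le hσ]
      exact (h2.mono Ioc_subset_Icc_self).aestronglyMeasurable measurableSet_Ioc
    have h3 : AEStronglyMeasurable w (volume.restrict (uIoc 0 σ)) := hw.def'.aestronglyMeasurable
    exact (ContinuousLinearMap.id ℝ (EuclideanSpace ℝ (Fin 3) →L[ℝ] ℝ)).aestronglyMeasurable_comp₂ h1 h3
  have hbound : ∀ᵐ s ∂(volume.restrict (uIoc 0 σ)), ‖fderiv ℝ f (γ s) (w s)‖ ≤ M * ‖w s‖ := by
    rw [uIoc_of_le hσ, ae_restrict_iff' measurableSet_Ioc]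
    refine Eventually.of_forall fun s hs => ?_
    exact (le_opNorm _ _).trans (mul_le_mul_of_nonneg_right (hM _ (hγK' s (Ioc_subset_Icc_self hs))) (norm_nonneg _))
  have hint : IntervalIntegrable (fun s => fderiv ℝ f (γ s) (w s)) volume 0 σ := by
    rw [intervalIntegrable_iff]
    exact Integrable.mono' ((intervalIntegrable_iff.1 hw).norm.const_mul M) hm hbound
  refine ⟨hint, ?_⟩
  -- ### the approximation argument: `‖f(γ σ) − f y + ∫ Df(γ)[w]‖ ≤ η` for every `η > 0`
  have key : ∀ η : ℝ, 0 < η → ‖f (γ σ) - f y + ∫ s in (0 : ℝ)..σ, fderiv ℝ f (γ s) (w s)‖ ≤ η := by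
    intro η hη
    -- uniform continuity of `Df` on `K`
    have hUC := hKc.uniformContinuousOn_of_continuous hDfc.continuousOn
    rw [Metric.uniformContinuousOn_iff] at hUC
    obtain ⟨δ, hδ, hUCδ⟩ := hUC (η / (2 * (I + 1))) (by positivity)
    -- the tolerance and the continuous approximant
    set ε : ℝ := min (δ / 2) (min 1 (η / (4 * (M + 1)))) with hε
    have hε0 : 0 < ε := by positivity
    have hεδ : ε < δ := lt_of_le_of_lt (min_le_left _ _) (by linarith)
    have hε1 : ε ≤ 1 := (min_le_right _ _).trans (min_le_left _ _)
    have hεη : ε ≤ η / (4 * (M + 1)) := (min_le_right _ _).trans (min_le_right _ _)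
    set W0 : ℝ → EuclideanSpace ℝ (Fin 3) := (Ioc 0 σ).indicator w with hW0
    have hW0i : Integrable W0 volume :=
      ((intervalIntegrable_iff_integrableOn_Ioc_of_le hσ).1 hw).integrable_indicator measurableSet_Ioc
    obtain ⟨g, hg, hgmem⟩ := (memLp_one_iff_integrable.2 hW0i).exists_boundedContinuous_eLpNorm_sub_le ENNReal.one_ne_top
      (ε := ENNReal.ofReal ε) (by simpa using hε0)
    have hgc : Continuous (g : ℝ → EuclideanSpace ℝ (Fin 3)) := g.continuous
    have hgi : Integrable (g : ℝ → EuclideanSpace ℝ (Fin 3)) volume := memLp_one_iff_integrable.1 hgmem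
    have hgI : ∀ a b : ℝ, IntervalIntegrable (g : ℝ → EuclideanSpace ℝ (Fin 3)) volume a b := fun a b =>
      hgc.intervalIntegrable a b
    -- `∫₀^σ ‖w − g‖ ≤ ε`
    have hL1 : ∫ s, ‖W0 s - g s‖ ≤ ε := by
      have h1 : ∫ s, ‖(W0 - (g : ℝ → EuclideanSpace ℝ (Fin 3))) s‖ =
          (eLpNorm (W0 - (g : ℝ → EuclideanSpace ℝ (Fin 3))) 1 volume).toReal := by
        rw [integral_norm_eq_lintegral_enorm (hW0i.sub hgi).aestronglyMeasurable, eLpNorm_one_eq_lintegral_enorm]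
      have h2 : (∫ s, ‖W0 s - g s‖) = ∫ s, ‖(W0 - (g : ℝ → EuclideanSpace ℝ (Fin 3))) s‖ := rfl
      rw [h2, h1]
      exact ENNReal.toReal_le_of_le_ofReal hε0.le hg
    have hwg : ∫ s in (0 : ℝ)..σ, ‖w s - g s‖ ≤ ε := by
      rw [integral_of_le hσ]
      calc ∫ s in Ioc 0 σ, ‖w s - g s‖ = ∫ s in Ioc 0 σ, ‖W0 s - g s‖ :=
            setIntegral_congr_fun measurableSet_Ioc fun s hs => by simp only [hW0, indicator_of_mem hs]
        _ ≤ ∫ s, ‖W0 s - g s‖ := setIntegral_le_integral (hW0i.sub hgi).norm (Eventually.of_forall fun _ => norm_nonneg _)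
        _ ≤ ε := hL1
    have hwgI : IntervalIntegrable (fun s => w s - g s) volume 0 σ := hw.sub (hgI 0 σ)
    -- the `C¹` curve `γg = y − ∫ g` and the FTC along it
    set γg : ℝ → EuclideanSpace ℝ (Fin 3) := fun s => y - ∫ r in (0 : ℝ)..s, g r with hγg
    have hγg' : ∀ s, HasDerivAt γg (-g s) s := fun s => by
      have h := (hgc.integral_hasStrictDerivAt 0 s).hasDerivAt
      exact h.const_sub y
    have hγgc : Continuous γg := continuous_iff_continuousAt.2 fun s => (hγg' s).continuousAt
    have hF' : ∀ s, HasDerivAt (fun r => f (γg r)) (fderiv ℝ f (γg s) (-g s)) s := fun s =>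
      (hfd (γg s)).hasFDerivAt.comp_hasDerivAt s (hγg' s)
    have hF'c : Continuous fun s => fderiv ℝ f (γg s) (-g s) :=
      (hDfc.comp hγgc).clm_apply hgc.neg
    have hFTC : ∫ s in (0 : ℝ)..σ, fderiv ℝ f (γg s) (-g s) = f (γg σ) - f y := by
      have h := integral_eq_sub_of_hasDerivAt (fun s _ => hF' s) (hF'c.intervalIntegrable 0 σ)
      rw [h]
      simp only [hγg, integral_same, sub_zero]
    -- uniform closeness of the two curves on `[0,σ]`
    have hclose : ∀ s ∈ Icc 0 σ, ‖γg s - γ s‖ ≤ ε := by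
      intro s hs
      have hws : IntervalIntegrable w volume 0 s :=
        hw.mono_set (by rw [uIcc_of_le hσ, uIcc_of_le hs.1]; exact Icc_subset_Icc le_rfl hs.2)
      have e : γg s - γ s = ∫ r in (0 : ℝ)..s, (w r - g r) := by
        rw [hγ s hs, integral_sub hws (hgI 0 s)]
        show (y - ∫ r in (0 : ℝ)..s, g r) - (y - ∫ r in (0 : ℝ)..s, w r) = _
        exact sub_sub_sub_cancel_left _ _ _
      rw [e]
      calc ‖∫ r in (0 : ℝ)..s, (w r - g r)‖ ≤ ∫ r in (0 : ℝ)..σ, ‖w r - g r‖ :=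
            norm_integral_le_integral_norm_of_mem hwgI hs
        _ ≤ ε := hwg
    have hγgK : ∀ s ∈ Icc 0 σ, γg s ∈ K := by
      intro s hs
      rw [hK, mem_closedBall, dist_eq_norm]
      have h1 := hclose s hs
      have h2 : ‖γ s - y‖ ≤ I := by rw [← dist_eq_norm]; exact hγK s hs
      calc ‖γg s - y‖ = ‖(γg s - γ s) + (γ s - y)‖ := by rw [sub_add_sub_cancel]
        _ ≤ ‖γg s - γ s‖ + ‖γ s - y‖ := norm_add_le _ _
        _ ≤ I + 1 := by linarith
    -- E1: the endpoints
    have hE1 : ‖f (γ σ) - f (γg σ)‖ ≤ M * ε := by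
      have hσm : σ ∈ Icc 0 σ := ⟨hσ, le_rfl⟩
      have h := hKconv.norm_image_sub_le_of_norm_fderiv_le (fun x _ => hfd x) (fun x hx => hM x hx)
        (hγgK σ hσm) (hγK' σ hσm)
      calc ‖f (γ σ) - f (γg σ)‖ ≤ M * ‖γ σ - γg σ‖ := h
        _ ≤ M * ε := by
            refine mul_le_mul_of_nonneg_left ?_ hM0
            rw [← norm_neg, neg_sub]; exact hclose σ hσm
    -- E2: the integrals
    have hE2 : ‖(∫ s in (0 : ℝ)..σ, fderiv ℝ f (γ s) (w s)) - ∫ s in (0 : ℝ)..σ, fderiv ℝ f (γg s) (g s)‖ ≤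
        M * ε + η / (2 * (I + 1)) * I := by
      have hGc : Continuous fun s => fderiv ℝ f (γg s) (g s) := (hDfc.comp hγgc).clm_apply hgc
      have hGI : IntervalIntegrable (fun s => fderiv ℝ f (γg s) (g s)) volume 0 σ := hGc.intervalIntegrable 0 σ
      rw [← integral_sub hint hGI]
      have hbd : ∀ s ∈ Icc 0 σ, ‖fderiv ℝ f (γ s) (w s) - fderiv ℝ f (γg s) (g s)‖ ≤
          M * ‖w s - g s‖ + η / (2 * (I + 1)) * ‖w s‖ := by
        intro s hs
        have e : fderiv ℝ f (γ s) (w s) - fderiv ℝ f (γg s) (g s) =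
            fderiv ℝ f (γg s) (w s - g s) + (fderiv ℝ f (γ s) - fderiv ℝ f (γg s)) (w s) := by
          rw [map_sub, sub_apply]; abel
        rw [e]
        have h1 : ‖fderiv ℝ f (γg s) (w s - g s)‖ ≤ M * ‖w s - g s‖ :=
          (le_opNorm _ _).trans (mul_le_mul_of_nonneg_right (hM _ (hγgK s hs)) (norm_nonneg _))
        have h2 : ‖(fderiv ℝ f (γ s) - fderiv ℝ f (γg s)) (w s)‖ ≤ η / (2 * (I + 1)) * ‖w s‖ := by
          refine (le_opNorm _ _).trans (mul_le_mul_of_nonneg_right ?_ (norm_nonneg _))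
          have hd : dist (γ s) (γg s) < δ := by
            rw [dist_comm, dist_eq_norm]; exact lt_of_le_of_lt (hclose s hs) hεδ
          have := hUCδ (γ s) (hγK' s hs) (γg s) (hγgK s hs) hd
          rw [dist_eq_norm] at this
          exact this.le
        exact (norm_add_le _ _).trans (add_le_add h1 h2)
      have hBI : IntervalIntegrable (fun s => M * ‖w s - g s‖ + η / (2 * (I + 1)) * ‖w s‖) volume 0 σ :=
        (hwgI.norm.const_mul M).add (hw.norm.const_mul _)
      calc ‖∫ s in (0 : ℝ)..σ, (fderiv ℝ f (γ s) (w s) - fderiv ℝ f (γg s) (g s))‖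
          ≤ ∫ s in (0 : ℝ)..σ, ‖fderiv ℝ f (γ s) (w s) - fderiv ℝ f (γg s) (g s)‖ := norm_integral_le_integral_norm hσ
        _ ≤ ∫ s in (0 : ℝ)..σ, (M * ‖w s - g s‖ + η / (2 * (I + 1)) * ‖w s‖) :=
            integral_mono_on hσ (hint.sub hGI).norm hBI hbd
        _ = M * (∫ s in (0 : ℝ)..σ, ‖w s - g s‖) + η / (2 * (I + 1)) * I := by
            rw [integral_add (hwgI.norm.const_mul M) (hw.norm.const_mul _), intervalIntegral.integral_const_mul,
              intervalIntegral.integral_const_mul]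
        _ ≤ M * ε + η / (2 * (I + 1)) * I := by
            have := mul_le_mul_of_nonneg_left hwg hM0
            linarith
    -- assemble
    have hmid : f (γg σ) - f y + ∫ s in (0 : ℝ)..σ, fderiv ℝ f (γg s) (g s) = 0 := by
      have e : ∫ s in (0 : ℝ)..σ, fderiv ℝ f (γg s) (-g s) = -∫ s in (0 : ℝ)..σ, fderiv ℝ f (γg s) (g s) := by
        rw [← intervalIntegral.integral_neg]
        refine integral_congr fun s _ => ?_
        simp only [map_neg]
      rw [e] at hFTC
      linarith
    have hsplit : f (γ σ) - f y + (∫ s in (0 : ℝ)..σ, fderiv ℝ f (γ s) (w s)) =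
        (f (γ σ) - f (γg σ)) + (f (γg σ) - f y + ∫ s in (0 : ℝ)..σ, fderiv ℝ f (γg s) (g s)) +
          ((∫ s in (0 : ℝ)..σ, fderiv ℝ f (γ s) (w s)) - ∫ s in (0 : ℝ)..σ, fderiv ℝ f (γg s) (g s)) := by ring
    rw [hsplit, hmid, add_zero]
    have hηI : η / (2 * (I + 1)) * I ≤ η / 2 := by
      rw [div_mul_eq_mul_div, div_le_div_iff₀ (by positivity) (by positivity)]
      nlinarith
    have hMε : M * ε ≤ η / 4 := by
      calc M * ε ≤ (M + 1) * (η / (4 * (M + 1))) := by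
            exact mul_le_mul (by linarith) hεη hε0.le (by linarith)
        _ = η / 4 := by field_simp
    calc ‖(f (γ σ) - f (γg σ)) + ((∫ s in (0 : ℝ)..σ, fderiv ℝ f (γ s) (w s)) - ∫ s in (0 : ℝ)..σ, fderiv ℝ f (γg s) (g s))‖
        ≤ ‖f (γ σ) - f (γg σ)‖ + ‖(∫ s in (0 : ℝ)..σ, fderiv ℝ f (γ s) (w s)) - ∫ s in (0 : ℝ)..σ, fderiv ℝ f (γg s) (g s)‖ :=
          norm_add_le _ _
      _ ≤ M * ε + (M * ε + η / (2 * (I + 1)) * I) := add_le_add hE1 hE2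
      _ ≤ η := by linarith
  -- ### conclusion
  have h0 : ‖f (γ σ) - f y + ∫ s in (0 : ℝ)..σ, fderiv ℝ f (γ s) (w s)‖ = 0 := by
    refine le_antisymm ?_ (norm_nonneg _)
    by_contra h
    have hpos : 0 < ‖f (γ σ) - f y + ∫ s in (0 : ℝ)..σ, fderiv ℝ f (γ s) (w s)‖ := lt_of_not_ge h
    have := key _ (half_pos hpos)
    linarith
  rw [norm_eq_zero] at h0
  linarith

/-! ### Along the backward flow: `HasChainRule` for `C¹` observables -/

/-- **THE LAGRANGIAN CHAIN RULE FOR `C¹` OBSERVABLES ALONG A.E. BACKWARD ORBIT.**  If for a.e. label `y` the curve `σ ↦ Ψ_σ y` is an integral curve of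
`−W` on `[0,∞)` in integral form (`W = selfSimilarTransport γ 0 V`; clause (3) of the line's `IsBackwardFlow`), then for every `f ∈ C¹(ℝ³; ℝ)`, every `σ ≥ 0`
and a.e. `y`: `s ↦ Df(Ψ_s y)[W(Ψ_s y)]` is integrable on `(0,σ)` and `f(Ψ_σ y) = f(y) − ∫₀^σ Df(Ψ_s y)[W(Ψ_s y)] ds` — the line's `HasChainRule` for the pair
`(f, fderiv ℝ f)`. [folklore; AmbrosioCrippa2008 (RLF setting)] -/
theorem chainRule_of_contDiff {γ : ℝ} {V : EuclideanSpace ℝ (Fin 3) → EuclideanSpace ℝ (Fin 3)}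
    {Ψ : ℝ → EuclideanSpace ℝ (Fin 3) → EuclideanSpace ℝ (Fin 3)}
    (hcurve : ∀ᵐ y ∂(volume : Measure (EuclideanSpace ℝ (Fin 3))), ∀ σ : ℝ, 0 ≤ σ →
      IntervalIntegrable (fun s => selfSimilarTransport γ 0 V (Ψ s y)) volume 0 σ ∧
        Ψ σ y = y - ∫ s in (0 : ℝ)..σ, selfSimilarTransport γ 0 V (Ψ s y))
    {f : EuclideanSpace ℝ (Fin 3) → ℝ} (hf : ContDiff ℝ 1 f) {σ : ℝ} (hσ : 0 ≤ σ) :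
    ∀ᵐ y ∂(volume : Measure (EuclideanSpace ℝ (Fin 3))),
      IntervalIntegrable (fun s => fderiv ℝ f (Ψ s y) (selfSimilarTransport γ 0 V (Ψ s y))) volume 0 σ ∧
        f (Ψ σ y) = f y - ∫ s in (0 : ℝ)..σ, fderiv ℝ f (Ψ s y) (selfSimilarTransport γ 0 V (Ψ s y)) := by
  filter_upwards [hcurve] with y hy
  exact comp_curve_eq_sub_integral (γ := fun s => Ψ s y) (w := fun s => selfSimilarTransport γ 0 V (Ψ s y)) hf hσ
    (hy σ hσ).1 (fun s hs => (hy s hs.1).2)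

end Summit.NavierStokesRegularity.NavierStokesRegularity.Theorems.PowerGaugeEulerLiouville.WeakLagrangian

end
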